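import Summits.RiemannHypothesis.RiemannHypothesis.Theorems.WeilParityEvenWinsBeyondArchParityCell91
import Summits.RiemannHypothesis.RiemannHypothesis.Theorems.GroundBartaEvenWinsBeyondArchUpper91Sharp
import Summits.RiemannHypothesis.RiemannHypothesis.Theorems.WeilFormatCDataO94OddRung
import Summits.RiemannHypothesis.RiemannHypothesis.Theorems.GroundBartaEvenWinsBeyondArchUpper94Sharp
import Summits.RiemannHypothesis.RiemannHypothesis.Theorems.WeilFormatCDataO97OddRung
import Summits.RiemannHypothesis.RiemannHypothesis.Theorems.GroundBartaEvenWinsBeyondArchUpper9729Sharp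
import Summits.RiemannHypothesis.RiemannHypothesis.Theorems.WeilFormatCDataO100OddRung
import Summits.RiemannHypothesis.RiemannHypothesis.Theorems.GroundBartaEvenWinsBeyondArchUpper100Sharp
import Summits.RiemannHypothesis.RiemannHypothesis.Theorems.WeilFormatCDataO102BOddRung
import Summits.RiemannHypothesis.RiemannHypothesis.Theorems.WeilGroundStateGroundStateSimpleEvenCellTransfer
import Literature.NumberTheory.LFunctions.WeilGroundEnergyParitySplit
import HarnessLib

/-!
# RiemannHypothesis / GroundBarta — the parity ladder: PARITY CELL 13 `(1, 51/50]` CLOSED — the ladder passes the positivity frontier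

Helper file (`--supports stmt-RiemannHypothesis-18085`, `NoParityCrossing`), RH-free.  Prover A (g24 of unit `sr-gb-rung-a`), after
prover A g23's `…ParityCell100` (cell 12, the ladder up to `a = 1`).

The ladder step on `[1, 51/50]` (`ε`, `ε_od` antitone; `GroundStateSimpleEven.weilWindowSimpleEven_on_cell_of_le`) from three tree facts:
* the ladder up to `91/100` (cells 1–9): `weilWindowSimpleEven_upTo_91` (`…ParityCell91`), and the cell-10/11/12 steps re-derived inline from
  `trialUpper91sharp` + `WeilFormatCData.O94.weilOddGroundEnergy_94_ge_inv_two_pow_75`, `trialUpper94sharp` +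
  `WeilFormatCData.O97.weilOddGroundEnergy_9729_ge_inv_two_pow_81` and `trialUpper9729sharp` +
  `WeilFormatCData.O100.weilOddGroundEnergy_one_ge_inv_two_pow_88` (= `weilWindowSimpleEven_upTo_94/_9729/_one` of `…ParityCell94/97/100`,
  whose hub oleans were pending — not imported);
* the U-side at `1`: `trialUpper100sharp : ε(1) ≤ 5566·10⁻³²` (`…Upper100Sharp`: even degree-94 Ritz vector `ne100v1`, n = 48, kit j252976,
  Ritz value 6.28·10⁻³⁰; A-layer certificate `ne100v1_T` with the FIVE-prime-power kernel enclosures `primeBoundsY7`, killing constant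
  `dt_f7_weilMarkovConstant_sharp5` of `…DeflationFivePrimeWindow` — the first `{2,3,4,5,7}`-window U-side);
* the L-side at `51/50`: `WeilFormatCData.O102B.weilOddGroundEnergy_102_ge_inv_two_pow_93 : 2⁻⁹³ ≤ ε_od(51/50)`
  (`WeilFormatCDataO102BOddRung`, the format-C ODD λ-run at `a = 51/50` with the five prime powers `2, 3, 4, 5, 7`
  (`WeilFormatC.primeCoeff_form_ge_cells_v2`, `A = 2148/1000`), odd block `256`, HIGHER kit precision `S = 2^320` / unit `2^-310`,
  `μ = 2⁻⁹³ = 1.01·10⁻²⁸ > 5566·10⁻³²`; 223 kernel-checked data / certificate / assembly modules, prover A g23's run).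

* `weilWindowSimpleEven_upTo_102` — for every `0 < a ≤ 51/50` the ground state of the windowed Weil form is simple and even;
* `weilEvenGroundEnergy_lt_weilOddGroundEnergy_upTo_102`, `tailSimpleEven_upTo_102`, `noParityCrossing_upTo_102` — the strict parity order /
  the item-18085 tail shape / the crux `NoParityCrossing` on the certified range `(0, 51/50]`.

Standard axioms; nothing is defined; no RH claim (a finite-range parity certificate).
-/

set_option linter.dupNamespace false

noncomputable section

open Set MeasureTheory

namespace Summit.RiemannHypothesis.RiemannHypothesis.Theorems.EvenWinsBeyondArch

open Literature.NumberTheory.LFunctions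

/-- **Parity cell 13 closed: the ladder reaches `51/50`, past the positivity frontier `a = 1`.**  For every window
`0 < a ≤ 51/50` the windowed Weil form has a simple, even ground state. [folklore] -/
theorem weilWindowSimpleEven_upTo_102 : ∀ a : ℝ, 0 < a → a ≤ 51 / 50 → WeilWindowSimpleEven a := by
  intro a ha hac
  rcases le_or_gt a 1 with hab | hba
  · -- cells 1–12 (`weilWindowSimpleEven_upTo_one` of `…ParityCell100`, re-derived from built modules only)
    rcases le_or_gt a (9729 / 10000) with hab12 | hba12
    · rcases le_or_gt a (47 / 50) with hab10 | hba10
      · rcases le_or_gt a (91 / 100) with hab9 | hba9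
        · exact weilWindowSimpleEven_upTo_91 a ha hab9
        · have hU9 := trialUpper91sharp
          have hL10 := WeilFormatCData.O94.weilOddGroundEnergy_94_ge_inv_two_pow_75
          have hUL9 : (2589 / 100000000000000000000000000 : ℝ) < (1 / 2 ^ 75 : ℝ) := by norm_num
          exact GroundStateSimpleEven.weilWindowSimpleEven_on_cell_of_le (b := 91 / 100) (c := 47 / 50) (by norm_num) hUL9 hU9
            (fun _ hg hs hn ho ↦ hL10.trans (weilOddGroundEnergy_le hg hs ho hn)) hba9.le hab10
      · have hU10 := trialUpper94sharp
        have hL11 := WeilFormatCData.O97.weilOddGroundEnergy_9729_ge_inv_two_pow_81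
        have hUL10 : (2322 / 10000000000000000000000000000 : ℝ) < (1 / 2 ^ 81 : ℝ) := by norm_num
        exact GroundStateSimpleEven.weilWindowSimpleEven_on_cell_of_le (b := 47 / 50) (c := 9729 / 10000) (by norm_num) hUL10 hU10
          (fun _ hg hs hn ho ↦ hL11.trans (weilOddGroundEnergy_le hg hs ho hn)) hba10.le hab12
    · have hU12 := trialUpper9729sharp
      have hL12 := WeilFormatCData.O100.weilOddGroundEnergy_one_ge_inv_two_pow_88
      have hUL12 : (9899 / 10000000000000000000000000000000 : ℝ) < (1 / 2 ^ 88 : ℝ) := by norm_num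
      exact GroundStateSimpleEven.weilWindowSimpleEven_on_cell_of_le (b := 9729 / 10000) (c := 1) (by norm_num) hUL12 hU12
        (fun _ hg hs hn ho ↦ hL12.trans (weilOddGroundEnergy_le hg hs ho hn)) hba12.le hab
  · -- cell 13: U(1) = 5566e-32 < 2^-93 ≤ ε_od(51/50)
    have hU := trialUpper100sharp
    have hL := WeilFormatCData.O102B.weilOddGroundEnergy_102_ge_inv_two_pow_93
    have hUL : (5566 / 100000000000000000000000000000000 : ℝ) < (1 / 2 ^ 93 : ℝ) := by norm_num
    exact GroundStateSimpleEven.weilWindowSimpleEven_on_cell_of_le (b := 1) (c := (51 : ℝ) / 50) (by norm_num) hUL hU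
      (fun _ hg hs hn ho ↦ hL.trans (weilOddGroundEnergy_le hg hs ho hn)) hba.le hac

/-- The strict parity order `ε_ev(a) < ε_od(a)` for every `0 < a ≤ 51/50`. [folklore] -/
theorem weilEvenGroundEnergy_lt_weilOddGroundEnergy_upTo_102 {a : ℝ} (ha : 0 < a) (hle : a ≤ 51 / 50) :
    weilEvenGroundEnergy a < weilOddGroundEnergy a :=
  (weilWindowSimpleEven_iff_weilEvenGroundEnergy_lt ha).1 (weilWindowSimpleEven_upTo_102 a ha hle)

/-- Tail shape of item 18085 up to `51/50`: simple even ground states on every window `log 2 < a ≤ 51/50`. [folklore] -/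
theorem tailSimpleEven_upTo_102 : ∀ a : ℝ, Real.log 2 < a → a ≤ 51 / 50 → WeilWindowSimpleEven a :=
  fun a ha hle ↦ weilWindowSimpleEven_upTo_102 a ((Real.log_pos (by norm_num)).trans ha) hle

/-- **Item 18085's statement restricted to the certified range**: for every window `(log 3)/2 < a ≤ 51/50` the even and odd
sector bottoms do not coincide, `ε_ev(a) ≠ ε_od(a)` — the crux `NoParityCrossing` verified on the finite range of the parity
ladder (cells 1–13). [folklore] -/
theorem noParityCrossing_upTo_102 : ∀ a : ℝ, Real.log 3 / 2 < a → a ≤ 51 / 50 →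
    weilEvenGroundEnergy a ≠ weilOddGroundEnergy a :=
  fun a ha hle ↦ (weilEvenGroundEnergy_lt_weilOddGroundEnergy_upTo_102
    ((div_pos (Real.log_pos (by norm_num)) two_pos).trans ha) hle).ne

/-- The positivity frontier is now INSIDE the parity-certified range: simple even ground states on every window
`1 ≤ a ≤ 51/50` (the first cell of the `{2,3,4,5,7}`-regime). [folklore] -/
theorem weilWindowSimpleEven_on_cell13 {a : ℝ} (h1 : 1 ≤ a) (hle : a ≤ 51 / 50) : WeilWindowSimpleEven a :=
  weilWindowSimpleEven_upTo_102 a (one_pos.trans_le h1) hle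

end Summit.RiemannHypothesis.RiemannHypothesis.Theorems.EvenWinsBeyondArch

end
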